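import Mathlib
import Summits.Ventures.HodgeRepro.Tier4.Common.AdelicDefs
import Summits.Ventures.HodgeRepro.Tier4.Common.SettingOfData
import Summits.Ventures.HodgeRepro.Tier4.Line1.PlaneDefs
import Summits.Ventures.HodgeRepro.Tier4.Line1.RowBasis
import Summits.Ventures.HodgeRepro.Tier4.Line1.AdelicParts
import Summits.Ventures.HodgeRepro.Tier4.Line1.LinRegular
import Summits.Ventures.HodgeRepro.Tier4.Line4.OrbitBlocks
import Summits.Ventures.HodgeRepro.Tier4.Line4.RationalLineScalars
import Summits.Ventures.HodgeRepro.Tier4.Line4.RowLineCoords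
import Summits.Ventures.HodgeRepro.Tier4.Line4.QuadraticScalars

/-!
# Tier4/Line4/OrbitFibre — C-L4-TAIL (S2′)(ii), the FIBRE BOUND: the `(0,0)`-norm is INJECTIVE on regular rational
double cosets

Blind re-derivation cell `pub-hodge-repro`, Tier 4 «PROVE THE STEP» (README §9–§10), LINE L4, cut C-L4-TAIL (S2′)(ii)
(lead (R-27) S15050; TAKEN S15052), seat t4-L2-p3 (gen 4); module 4 (the assembly).

THE STATEMENT.  In the row model (`w_i` spanning the `P_i`-line, `v_j` spanning the `Q_j`-line, all four lines
`β`-non-degenerate), a rational unitary `g` has the four `E′`-block scalars `s_ij` with `(w_i g) Q_j = v_j (s_ij)`;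
the invariant is `N(s₀₀) = x₀₀² + d y₀₀²`.  **`exists_torus_conj_of_scalar_nrm_eq`**: two REGULAR rational unitaries
(all four block scalars non-zero) with the same `(0,0)`-norm are conjugate by rational torus elements,
`g′ = e g e′` with `e ∈ T(k)`, `e′ ∈ T′(k)` — so the fibre of the invariant over a regular value has ONE double coset
(**`orbitOf_eq_of_scalar_nrm_eq`** on `Setting.ofAdelicData`).

THE PROOF.  Unitarity `g B gᵀ = B` on the rows `w_i` and `w_i Ω` is, in the field `E′ = k[Ω]`, the hermitian system
`Σ_j s_ij σ(s_i′j) b_j = δ_ii′ a_i` (`a_i = β(w_i, w_i)`, `b_j = β(v_j, v_j)`; RowLineCoords' `form_vecMul_escK` for the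
real part, the `Ω`-twisted rows for the imaginary part); QuadraticScalars' `exists_normalise` produces norm-one
`ε_i`, `ε′_j` with `s′_ij = ε_i s_ij ε′_j`; the torus elements `e = Σ ε_i P_i`, `e′ = Σ ε′_j Q_j` (RationalLineScalars'
`torusMatK`) then satisfy `w_i (e g e′) = Σ_j v_j (ε_i s_ij ε′_j) = w_i g′` on the row basis, hence `e g e′ = g′`.

Mathlib + the landed modules only; no printed input; nothing here asserts anything about the truth of (P);
HC_CM is NOT proved by anyone in this repository.
-/

set_option autoImplicit false

noncomputable section

namespace Summit.Ventures.HodgeRepro.Tier4.Line4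

open Summit.Ventures.HodgeRepro.Tier4 Summit.Ventures.HodgeRepro.Tier4.Common
  Summit.Ventures.HodgeRepro.Tier4.Line1 Matrix Polynomial

variable {k : Type} [Field k]

/-! ## 1. The block scalars of a rational unitary and the hermitian relations -/

section Blocks

variable (W : PlaneData k)

/-- the rows `w_i` of the `P`-lines are killed by the other projector -/
theorem vecMul_P_of_ne {w : Fin 2 → Fin 4 → k} (hw : ∀ i, w i ᵥ* W.P i = w i) {i i' : Fin 2} (h : i ≠ i') :
    w i ᵥ* W.P i' = 0 := by
  rw [← hw i, vecMul_vecMul, mul_eq_zero_of_ne W.P W.P_idem W.P_sum h, vecMul_zero]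

/-- the rows `w_i` of the `P`-lines are `β`-orthogonal -/
theorem form_w_eq_zero_of_ne (hPB : ∀ i, W.P i * W.B = W.B * (W.P i)ᵀ) {w : Fin 2 → Fin 4 → k}
    (hw : ∀ i, w i ᵥ* W.P i = w i) {i i' : Fin 2} (h : i ≠ i') : w i ᵥ* W.B ⬝ᵥ w i' = 0 := by
  rw [← hw i, ← hw i']
  exact form_eq_zero_of_proj_ne W (proj_mul_B_mul_transpose_eq_zero W W.P hPB W.P_idem W.P_sum h) _ _

/-- a row decomposes along the `Q`-lines: `u = u Q₀ + u Q₁` -/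
theorem vecMul_Q_sum (u : Fin 4 → k) : u = u ᵥ* W.Q 0 + u ᵥ* W.Q 1 := by
  rw [← vecMul_add, W.Q_sum, vecMul_one]

/-- **the hermitian relations of a rational unitary in `E′`**: for `(w_i g) Q_j = v_j (x_ij + y_ij Ω)`, with
`a_i = β(w_i, w_i)`, `b_j = β(v_j, v_j)`, and `s_ij = x_ij + y_ij · root ∈ E′`,
`Σ_j s_ij σ(s_i′j) b_j = δ_ii′ a_i` — the real part from `β(w_i g, w_i′ g) = β(w_i, w_i′)`, the imaginary part from
the same identity on the `Ω`-twisted rows `(w_i Ω) g = (w_i g) Ω`. -/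
theorem hermitian_relation [CharZero k] {d : k} (hΩ : W.Ω * W.Ω = -(d • (1 : Matrix (Fin 4) (Fin 4) k)))
    (hd : ¬ IsSquare (-d)) (hΩB : W.Ω * W.B = -(W.B * W.Ωᵀ)) (hPB : ∀ i, W.P i * W.B = W.B * (W.P i)ᵀ)
    (hQB : ∀ j, W.Q j * W.B = W.B * (W.Q j)ᵀ) {w : Fin 2 → Fin 4 → k} (hw : ∀ i, w i ᵥ* W.P i = w i)
    {v : Fin 2 → Fin 4 → k} {g : Matrix (Fin 4) (Fin 4) k} (hgΩ : g * W.Ω = W.Ω * g) (hgB : g * W.B * gᵀ = W.B)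
    {x y : Fin 2 → Fin 2 → k} (hxy : ∀ i j, (w i ᵥ* g) ᵥ* W.Q j = v j ᵥ* escK W (x i j) (y i j)) (i i' : Fin 2) :
    (algebraMap k _ (x i 0) + algebraMap k _ (y i 0) * AdjoinRoot.root ((X : k[X]) ^ 2 + C d)) *
        conjE d (algebraMap k _ (x i' 0) + algebraMap k _ (y i' 0) * AdjoinRoot.root ((X : k[X]) ^ 2 + C d)) *
        algebraMap k _ (v 0 ᵥ* W.B ⬝ᵥ v 0) +
      (algebraMap k _ (x i 1) + algebraMap k _ (y i 1) * AdjoinRoot.root ((X : k[X]) ^ 2 + C d)) *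
        conjE d (algebraMap k _ (x i' 1) + algebraMap k _ (y i' 1) * AdjoinRoot.root ((X : k[X]) ^ 2 + C d)) *
        algebraMap k _ (v 1 ᵥ* W.B ⬝ᵥ v 1) =
      algebraMap k _ (if i = i' then w i ᵥ* W.B ⬝ᵥ w i else 0) := by
  have hd0 : d ≠ 0 := by
    rintro rfl
    exact hd ⟨0, by simp⟩
  -- the blocks and their orthogonality
  have hQ01 : W.Q 0 * W.B * (W.Q 1)ᵀ = 0 := proj_mul_B_mul_transpose_eq_zero W W.Q hQB W.Q_idem W.Q_sum (by decide)
  have hQ10 : W.Q 1 * W.B * (W.Q 0)ᵀ = 0 := proj_mul_B_mul_transpose_eq_zero W W.Q hQB W.Q_idem W.Q_sum (by decide)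
  -- the real part: `β(w_i g, w_i′ g) = Σ_j (x_ij x_i′j + d y_ij y_i′j) b_j`
  have hre : ∀ i i', (w i ᵥ* g) ᵥ* W.B ⬝ᵥ (w i' ᵥ* g) =
      (x i 0 * x i' 0 + d * (y i 0 * y i' 0)) * (v 0 ᵥ* W.B ⬝ᵥ v 0) +
        (x i 1 * x i' 1 + d * (y i 1 * y i' 1)) * (v 1 ᵥ* W.B ⬝ᵥ v 1) := by
    intro i i'
    conv_lhs => rw [vecMul_Q_sum W (w i ᵥ* g), vecMul_Q_sum W (w i' ᵥ* g)]
    simp only [add_vecMul, add_dotProduct, dotProduct_add]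
    rw [form_eq_zero_of_proj_ne W hQ01, form_eq_zero_of_proj_ne W hQ10, hxy i 0, hxy i' 0, hxy i 1, hxy i' 1,
      form_vecMul_escK W hΩ hΩB, form_vecMul_escK W hΩ hΩB]
    ring
  -- the twisted rows: `((w_i g) Ω) Q_j = v_j (−d y_ij + x_ij Ω)`
  have hxyΩ : ∀ i j, ((w i ᵥ* g) ᵥ* W.Ω) ᵥ* W.Q j = v j ᵥ* escK W (-(d * y i j)) (x i j) := by
    intro i j
    rw [vecMul_vecMul, ← W.Q_comm j, ← vecMul_vecMul, hxy i j, vecMul_escK_Omega W hΩ]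
  have him : ∀ i i', ((w i ᵥ* g) ᵥ* W.Ω) ᵥ* W.B ⬝ᵥ (w i' ᵥ* g) =
      (-(d * y i 0) * x i' 0 + d * (x i 0 * y i' 0)) * (v 0 ᵥ* W.B ⬝ᵥ v 0) +
        (-(d * y i 1) * x i' 1 + d * (x i 1 * y i' 1)) * (v 1 ᵥ* W.B ⬝ᵥ v 1) := by
    intro i i'
    conv_lhs => rw [vecMul_Q_sum W ((w i ᵥ* g) ᵥ* W.Ω), vecMul_Q_sum W (w i' ᵥ* g)]
    simp only [add_vecMul, add_dotProduct, dotProduct_add]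
    rw [form_eq_zero_of_proj_ne W hQ01, form_eq_zero_of_proj_ne W hQ10, hxyΩ i 0, hxy i' 0, hxyΩ i 1, hxy i' 1,
      form_vecMul_escK W hΩ hΩB, form_vecMul_escK W hΩ hΩB]
    ring
  -- the values: unitarity and the geometry of the `P`-rows
  have hU : (w i ᵥ* g) ᵥ* W.B ⬝ᵥ (w i' ᵥ* g) = if i = i' then w i ᵥ* W.B ⬝ᵥ w i else 0 := by
    rw [form_vecMul_unitary W hgB]
    by_cases h : i = i'
    · subst h; simp
    · rw [if_neg h]; exact form_w_eq_zero_of_ne W hPB hw h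
  have hUΩ : ((w i ᵥ* g) ᵥ* W.Ω) ᵥ* W.B ⬝ᵥ (w i' ᵥ* g) = 0 := by
    have hrow : (w i ᵥ* g) ᵥ* W.Ω = (w i ᵥ* W.Ω) ᵥ* g := by rw [vecMul_vecMul, hgΩ, vecMul_vecMul]
    rw [hrow, form_vecMul_unitary W hgB]
    by_cases h : i = i'
    · subst h; exact form_Omega_self_eq_zero W hΩB (w i)
    · -- `w_i Ω` lies in the `P_i`-line, orthogonal to `w_i′`
      have hwΩ : (w i ᵥ* W.Ω) ᵥ* W.P i = w i ᵥ* W.Ω := by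
        rw [vecMul_vecMul, ← W.P_comm i, ← vecMul_vecMul, hw i]
      rw [← hwΩ, ← hw i']
      exact form_eq_zero_of_proj_ne W (proj_mul_B_mul_transpose_eq_zero W W.P hPB W.P_idem W.P_sum h) _ _
  -- assemble in `E′`
  rw [mul_conjE_coords, mul_conjE_coords]
  have e1 := (hre i i').symm.trans hU
  have e2 := (him i i').symm.trans hUΩ
  -- imaginary part: `Σ_j (y_ij x_i′j − x_ij y_i′j) b_j = 0` (divide `e2` by `d`)
  have e2' : (y i 0 * x i' 0 - x i 0 * y i' 0) * (v 0 ᵥ* W.B ⬝ᵥ v 0) +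
      (y i 1 * x i' 1 - x i 1 * y i' 1) * (v 1 ᵥ* W.B ⬝ᵥ v 1) = 0 := by
    have : d * ((y i 0 * x i' 0 - x i 0 * y i' 0) * (v 0 ᵥ* W.B ⬝ᵥ v 0) +
        (y i 1 * x i' 1 - x i 1 * y i' 1) * (v 1 ᵥ* W.B ⬝ᵥ v 1)) = 0 := by
      linear_combination -e2
    exact (mul_eq_zero.1 this).resolve_left hd0
  have e1' := congrArg (algebraMap k (AdjoinRoot ((X : k[X]) ^ 2 + C d))) e1
  have e2'' := congrArg (algebraMap k (AdjoinRoot ((X : k[X]) ^ 2 + C d))) e2'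
  simp only [map_add, map_mul, map_sub, map_zero] at e1' e2'' ⊢
  linear_combination e1' + AdjoinRoot.root ((X : k[X]) ^ 2 + C d) * e2''

/-- a row `w_i` acts on `torusMatK P u v` by its own scalar: `w_i (Σ_a escK u_a v_a P_a) = w_i escK u_i v_i` -/
theorem vecMul_torusMatK {P : Fin 2 → Matrix (Fin 4) (Fin 4) k} (hPΩ : ∀ i, P i * W.Ω = W.Ω * P i)
    (hPi : ∀ i, P i * P i = P i) (hPs : P 0 + P 1 = 1) {w : Fin 2 → Fin 4 → k} (hw : ∀ i, w i ᵥ* P i = w i)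
    (u v : Fin 2 → k) (i : Fin 2) : w i ᵥ* torusMatK W P u v = w i ᵥ* escK W (u i) (v i) := by
  have hne : ∀ i i', i ≠ i' → w i ᵥ* P i' = 0 := by
    intro i i' h
    rw [← hw i, vecMul_vecMul, mul_eq_zero_of_ne P hPi hPs h, vecMul_zero]
  have key : ∀ a, w i ᵥ* (escK W (u a) (v a) * P a) = if i = a then w i ᵥ* escK W (u i) (v i) else 0 := by
    intro a
    rw [← vecMul_vecMul, vecMul_escK_comm W _ _ (hPΩ a)]
    by_cases h : i = a
    · subst h; rw [hw, if_pos rfl]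
    · rw [hne i a h, zero_vecMul, if_neg h]
  simp only [torusMatK, vecMul_add, key]
  fin_cases i <;> simp

/-- the block scalars of `g` are non-zero when the coordinates are -/
theorem block_scalar_ne_zero {d : k} (hΩ : W.Ω * W.Ω = -(d • (1 : Matrix (Fin 4) (Fin 4) k)))
    (hd : ¬ IsSquare (-d)) {z : Fin 4 → k} (hz : z ≠ 0) {x y : k} (hxy : ¬ (x = 0 ∧ y = 0)) :
    algebraMap k _ x + algebraMap k _ y * AdjoinRoot.root ((X : k[X]) ^ 2 + C d) ≠ 0 := by
  intro h
  have h1 := congrArg (toMat W hΩ) h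
  rw [toMat_of_add_mul_root, map_zero] at h1
  apply hxy
  exact (vecMul_escK_eq_zero_iff W hΩ hd hz).1 (by rw [h1, vecMul_zero])

/-- **THE FIBRE BOUND, MATRIX FORM**: two regular rational unitaries with the same `(0,0)`-norm are conjugate by
rational torus elements, `g′ = e g e′` with `e = torusMatK P u v`, `e′ = torusMatK Q u′ v′` of norm-one scalars. -/
theorem exists_torus_conj_of_scalar_nrm_eq [CharZero k] {d : k}
    (hΩ : W.Ω * W.Ω = -(d • (1 : Matrix (Fin 4) (Fin 4) k))) (hd : ¬ IsSquare (-d))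
    (hΩB : W.Ω * W.B = -(W.B * W.Ωᵀ)) (hPB : ∀ i, W.P i * W.B = W.B * (W.P i)ᵀ)
    (hQB : ∀ j, W.Q j * W.B = W.B * (W.Q j)ᵀ) {w : Fin 2 → Fin 4 → k} (hw : ∀ i, w i ᵥ* W.P i = w i)
    (hw0 : ∀ i, w i ≠ 0) {v : Fin 2 → Fin 4 → k} (hv : ∀ j, v j ᵥ* W.Q j = v j)
    (ha0 : w 0 ᵥ* W.B ⬝ᵥ w 0 ≠ 0) (hb : ∀ j, v j ᵥ* W.B ⬝ᵥ v j ≠ 0) {g g' : Matrix (Fin 4) (Fin 4) k}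
    (hgΩ : g * W.Ω = W.Ω * g) (hgB : g * W.B * gᵀ = W.B) (hg'Ω : g' * W.Ω = W.Ω * g')
    (hg'B : g' * W.B * g'ᵀ = W.B) {x y x' y' : Fin 2 → Fin 2 → k}
    (hxy : ∀ i j, (w i ᵥ* g) ᵥ* W.Q j = v j ᵥ* escK W (x i j) (y i j))
    (hxy' : ∀ i j, (w i ᵥ* g') ᵥ* W.Q j = v j ᵥ* escK W (x' i j) (y' i j))
    (hreg : ∀ i j, ¬ (x i j = 0 ∧ y i j = 0)) (hreg' : ∀ i j, ¬ (x' i j = 0 ∧ y' i j = 0))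
    (h00 : nrmK d (x' 0 0) (y' 0 0) = nrmK d (x 0 0) (y 0 0)) :
    ∃ u vv u' vv' : Fin 2 → k, (∀ i, nrmK d (u i) (vv i) = 1) ∧ (∀ j, nrmK d (u' j) (vv' j) = 1) ∧
      g' = torusMatK W W.P u vv * g * torusMatK W W.Q u' vv' := by
  haveI : Fact (Irreducible ((X : k[X]) ^ 2 + C d)) := ⟨irreducible_X_sq_add_C hd⟩
  -- the scalars in `E′`
  set s : Fin 2 → Fin 2 → AdjoinRoot ((X : k[X]) ^ 2 + C d) := fun i j =>
    algebraMap k _ (x i j) + algebraMap k _ (y i j) * AdjoinRoot.root ((X : k[X]) ^ 2 + C d) with hs_def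
  set s' : Fin 2 → Fin 2 → AdjoinRoot ((X : k[X]) ^ 2 + C d) := fun i j =>
    algebraMap k _ (x' i j) + algebraMap k _ (y' i j) * AdjoinRoot.root ((X : k[X]) ^ 2 + C d) with hs'_def
  set a : Fin 2 → AdjoinRoot ((X : k[X]) ^ 2 + C d) := fun i => algebraMap k _ (w i ᵥ* W.B ⬝ᵥ w i) with ha_def
  set b : Fin 2 → AdjoinRoot ((X : k[X]) ^ 2 + C d) := fun j => algebraMap k _ (v j ᵥ* W.B ⬝ᵥ v j) with hb_def
  have hinj : Function.Injective (algebraMap k (AdjoinRoot ((X : k[X]) ^ 2 + C d))) := by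
    rw [AdjoinRoot.algebraMap_eq]
    apply AdjoinRoot.of.injective_of_degree_ne_zero
    rw [degree_eq_natDegree (X_pow_add_C_ne_zero two_pos d), natDegree_X_pow_add_C]
    norm_num
  have hbE : ∀ j, b j ≠ 0 := fun j h => hb j (hinj (h.trans (map_zero _).symm))
  have hbσ : ∀ j, conjE d (b j) = b j := fun j => conjE_algebraMap d _
  have haE : a 0 ≠ 0 := fun h => ha0 (hinj (h.trans (map_zero _).symm))
  have hsE : ∀ i j, s i j ≠ 0 := fun i j => block_scalar_ne_zero W hΩ hd (hw0 0) (hreg i j)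
  have hs'E : ∀ i j, s' i j ≠ 0 := fun i j => block_scalar_ne_zero W hΩ hd (hw0 0) (hreg' i j)
  -- the hermitian relations
  have hR := hermitian_relation W hΩ hd hΩB hPB hQB hw hgΩ hgB hxy
  have hR' := hermitian_relation W hΩ hd hΩB hPB hQB hw hg'Ω hg'B hxy'
  have R00 := hR 0 0
  have R11 := hR 1 1
  have R01 := hR 0 1
  have R00' := hR' 0 0
  have R11' := hR' 1 1
  have R01' := hR' 0 1
  simp only [if_true, Fin.zero_eq_one_iff, OfNat.ofNat_ne_one, if_false, map_zero] at R00 R11 R01 R00' R11' R01'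
  have h00E : s' 0 0 * conjE d (s' 0 0) = s 0 0 * conjE d (s 0 0) := by
    simp only [hs_def, hs'_def]
    rw [mul_conjE_of_add_mul_root, mul_conjE_of_add_mul_root, h00]
  obtain ⟨ε, ε', hε, hε', hsε⟩ := exists_normalise (d := d) (s := s) (s' := s') (a := a) (b := b) hbE hbσ haE hsE hs'E
    R00 R11 R01 R00' R11' R01' h00E
  -- coordinates of the normalising scalars
  choose u vv hu using fun i => exists_coords_E' d (ε i)
  choose u' vv' hu' using fun j => exists_coords_E' d (ε' j)
  have hun : ∀ i, nrmK d (u i) (vv i) = 1 := fun i => nrmK_eq_one_of_mul_conjE_eq_one (by rw [← hu i]; exact hε i)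
  have hu'n : ∀ j, nrmK d (u' j) (vv' j) = 1 := fun j => nrmK_eq_one_of_mul_conjE_eq_one (by rw [← hu' j]; exact hε' j)
  refine ⟨u, vv, u', vv', hun, hu'n, ?_⟩
  -- the matrices of the scalars
  have hts : ∀ i j, toMat W hΩ (s i j) = escK W (x i j) (y i j) := fun i j => toMat_of_add_mul_root W hΩ _ _
  have hts' : ∀ i j, toMat W hΩ (s' i j) = escK W (x' i j) (y' i j) := fun i j => toMat_of_add_mul_root W hΩ _ _
  have htε : ∀ i, toMat W hΩ (ε i) = escK W (u i) (vv i) := fun i => by rw [hu i, toMat_of_add_mul_root]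
  have htε' : ∀ j, toMat W hΩ (ε' j) = escK W (u' j) (vv' j) := fun j => by rw [hu' j, toMat_of_add_mul_root]
  -- the rows `w_i` agree on both sides
  have hrow : ∀ i, w i ᵥ* (torusMatK W W.P u vv * g * torusMatK W W.Q u' vv') = w i ᵥ* g' := by
    intro i
    -- left: `w_i e = w_i escK ε_i`, then through `g`
    rw [← vecMul_vecMul, ← vecMul_vecMul, vecMul_torusMatK W W.P_comm W.P_idem W.P_sum hw u vv i,
      vecMul_escK_comm W _ _ hgΩ]
    -- split along the `Q`-lines
    conv_lhs => rw [vecMul_Q_sum W (w i ᵥ* g)]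
    conv_rhs => rw [vecMul_Q_sum W (w i ᵥ* g')]
    rw [hxy i 0, hxy i 1, hxy' i 0, hxy' i 1, add_vecMul, add_vecMul]
    -- each `Q_j`-piece: `v_j escK s_ij escK ε_i escK ε′_j = v_j escK s′_ij`
    have piece : ∀ j, (v j ᵥ* escK W (x i j) (y i j)) ᵥ* escK W (u i) (vv i) ᵥ* torusMatK W W.Q u' vv' =
        v j ᵥ* escK W (x' i j) (y' i j) := by
      intro j
      have hline : ∀ (z : Fin 4 → k), z ᵥ* W.Q j = z → z ᵥ* torusMatK W W.Q u' vv' = z ᵥ* escK W (u' j) (vv' j) := by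
        intro z hz
        have := vecMul_torusMatK W W.Q_comm W.Q_idem W.Q_sum (w := fun j' => if j' = j then z else v j')
          (fun j' => by by_cases h : j' = j <;> simp [h, hz, hv]) u' vv' j
        simpa using this
      rw [hline _ (vecMul_escK_vecMul_proj W _ _ (W.Q_comm j)
        (vecMul_escK_vecMul_proj W _ _ (W.Q_comm j) (hv j)))]
      rw [vecMul_vecMul, vecMul_vecMul, ← hts, ← htε, ← htε', ← map_mul, ← map_mul, ← hts']
      congr 2
      rw [hsε i j]
      ring
    rw [piece 0, piece 1]
  -- the `Ω`-twisted rows agree (both sides commute with `Ω`)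
  have hcomm : (torusMatK W W.P u vv * g * torusMatK W W.Q u' vv') * W.Ω =
      W.Ω * (torusMatK W W.P u vv * g * torusMatK W W.Q u' vv') := by
    have h1 := torusMatK_mul_Omega W W.P W.P_comm u vv
    have h2 := torusMatK_mul_Omega W W.Q W.Q_comm u' vv'
    calc torusMatK W W.P u vv * g * torusMatK W W.Q u' vv' * W.Ω
        = torusMatK W W.P u vv * g * (torusMatK W W.Q u' vv' * W.Ω) := by simp only [Matrix.mul_assoc]
      _ = torusMatK W W.P u vv * (g * W.Ω) * torusMatK W W.Q u' vv' := by rw [h2]; simp only [Matrix.mul_assoc]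
      _ = (torusMatK W W.P u vv * W.Ω) * g * torusMatK W W.Q u' vv' := by rw [hgΩ]; simp only [Matrix.mul_assoc]
      _ = W.Ω * (torusMatK W W.P u vv * g * torusMatK W W.Q u' vv') := by rw [h1]; simp only [Matrix.mul_assoc]
  have hrowΩ : ∀ i, (w i ᵥ* W.Ω) ᵥ* (torusMatK W W.P u vv * g * torusMatK W W.Q u' vv') = (w i ᵥ* W.Ω) ᵥ* g' := by
    intro i
    rw [vecMul_vecMul, ← hcomm, ← vecMul_vecMul, hrow i, vecMul_vecMul, hg'Ω, ← vecMul_vecMul]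
  -- conclude on the row basis
  have hP1 : w 1 ᵥ* W.P 0 = 0 := vecMul_P_of_ne W hw (by decide)
  have hdet := det_rowMat_ne_zero W hΩ hd (hw0 0) (hw0 1) (hw 0) hP1
  set R : Matrix (Fin 4) (Fin 4) k := Matrix.of fun i j => (![w 0, w 0 ᵥ* W.Ω, w 1, w 1 ᵥ* W.Ω] i) j with hR_def
  have hRmul : ∀ M : Matrix (Fin 4) (Fin 4) k, R * M = Matrix.of fun i => (![w 0, w 0 ᵥ* W.Ω, w 1, w 1 ᵥ* W.Ω] i) ᵥ* M := by
    intro M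
    ext i j
    simp only [hR_def, Matrix.mul_apply, Matrix.of_apply, vecMul, dotProduct]
  have hRM : R * g' = R * (torusMatK W W.P u vv * g * torusMatK W W.Q u' vv') := by
    rw [hRmul, hRmul]
    ext i j
    simp only [Matrix.of_apply]
    fin_cases i
    · simp [hrow 0]
    · simp [hrowΩ 0]
    · simp [hrow 1]
    · simp [hrowΩ 1]
  have hinv : IsUnit R.det := isUnit_iff_ne_zero.2 hdet
  calc g' = R⁻¹ * (R * g') := by rw [← Matrix.mul_assoc, Matrix.nonsing_inv_mul R hinv, Matrix.one_mul]
    _ = R⁻¹ * (R * (torusMatK W W.P u vv * g * torusMatK W W.Q u' vv')) := by rw [hRM]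
    _ = torusMatK W W.P u vv * g * torusMatK W W.Q u' vv' := by
        rw [← Matrix.mul_assoc, Matrix.nonsing_inv_mul R hinv, Matrix.one_mul]

end Blocks

/-! ## 2. The fibre bound on the adelic setting: one regular double coset per value of the invariant -/

section Setting

open MeasureTheory Summit.Ventures.HodgeRepro.Tier4.Line1.RTF

variable [NumberField k] (W : PlaneData k) [MeasurableSpace (GA W)] [BorelSpace (GA W)]
  (R : RTFData W) (μ : Measure (GA W)) [μ.IsHaarMeasure] [R.μT.IsHaarMeasure] [R.μT'.IsHaarMeasure]
  (DG : Set (GA W)) (fdG : IsFundamentalDomain (rationalPoints W) DG μ) (compG : IsCompact (closure DG))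
  (compT : IsCompact (closure R.DT)) (compT' : IsCompact (closure R.DT'))

omit [MeasurableSpace (GA W)] [BorelSpace (GA W)] in
/-- the rational matrix of a rational point commutes with `Ω` and is unitary -/
theorem rational_mat_props {γ : rationalPoints W} {g : Matrix (Fin 4) (Fin 4) k}
    (hg : adMat k g = GA.mat W (γ : GA W)) : g * W.Ω = W.Ω * g ∧ g * W.B * gᵀ = W.B := by
  have h := (mem_unitaryGroup W _).1 (γ : GA W).2
  constructor
  · apply adMat_injective
    rw [adMat_mul, adMat_mul, hg]
    exact h.1
  · apply adMat_injective
    rw [adMat_mul, adMat_mul, adMat_transpose, hg]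
    exact h.2

/-- **THE FIBRE BOUND on `Setting.ofAdelicData`**: two REGULAR rational points (all four block scalars non-zero) with the
same `(0,0)`-norm lie in ONE rational double coset — the fibre of the invariant over a regular value has one element. -/
theorem orbitOf_eq_of_scalar_nrm_eq {d : k} (hΩ : W.Ω * W.Ω = -(d • (1 : Matrix (Fin 4) (Fin 4) k)))
    (hd : ¬ IsSquare (-d)) (hΩB : W.Ω * W.B = -(W.B * W.Ωᵀ)) (hPB : ∀ i, W.P i * W.B = W.B * (W.P i)ᵀ)
    (hQB : ∀ j, W.Q j * W.B = W.B * (W.Q j)ᵀ) {w : Fin 2 → Fin 4 → k} (hw : ∀ i, w i ᵥ* W.P i = w i)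
    (hw0 : ∀ i, w i ≠ 0) {v : Fin 2 → Fin 4 → k} (hv : ∀ j, v j ᵥ* W.Q j = v j)
    (ha0 : w 0 ᵥ* W.B ⬝ᵥ w 0 ≠ 0) (hb : ∀ j, v j ᵥ* W.B ⬝ᵥ v j ≠ 0)
    {γ γ' : (Setting.ofAdelicData W R μ DG fdG compG compT compT').Gk} {g g' : Matrix (Fin 4) (Fin 4) k}
    (hg : adMat k g = GA.mat W (γ : GA W)) (hg' : adMat k g' = GA.mat W (γ' : GA W))
    {x y x' y' : Fin 2 → Fin 2 → k}
    (hxy : ∀ i j, (w i ᵥ* g) ᵥ* W.Q j = v j ᵥ* escK W (x i j) (y i j))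
    (hxy' : ∀ i j, (w i ᵥ* g') ᵥ* W.Q j = v j ᵥ* escK W (x' i j) (y' i j))
    (hreg : ∀ i j, ¬ (x i j = 0 ∧ y i j = 0)) (hreg' : ∀ i j, ¬ (x' i j = 0 ∧ y' i j = 0))
    (h00 : nrmK d (x' 0 0) (y' 0 0) = nrmK d (x 0 0) (y 0 0)) :
    (Setting.ofAdelicData W R μ DG fdG compG compT compT').orbitOf γ =
      (Setting.ofAdelicData W R μ DG fdG compG compT compT').orbitOf γ' := by
  obtain ⟨hgΩ, hgB⟩ := rational_mat_props W hg
  obtain ⟨hg'Ω, hg'B⟩ := rational_mat_props W hg'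
  obtain ⟨u, vv, u', vv', hun, hu'n, hconj⟩ := exists_torus_conj_of_scalar_nrm_eq W hΩ hd hΩB hPB hQB hw hw0 hv ha0
    hb hgΩ hgB hg'Ω hg'B hxy hxy' hreg hreg' h00
  -- the rational torus points
  set E : GA W := torusPtK W hΩ hΩB W.P W.P_comm hPB W.P_idem W.P_sum u vv hun with hE
  set E' : GA W := torusPtK W hΩ hΩB W.Q W.Q_comm hQB W.Q_idem W.Q_sum u' vv' hu'n with hE'
  have hErat : E ∈ rationalPoints W := torusPtK_mem_rationalPoints W hΩ hΩB W.P W.P_comm hPB W.P_idem W.P_sum u vv hun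
  have hE'rat : E' ∈ rationalPoints W :=
    torusPtK_mem_rationalPoints W hΩ hΩB W.Q W.Q_comm hQB W.Q_idem W.Q_sum u' vv' hu'n
  have hET : E ∈ torusT W := torusPtK_mem_torusT W hΩ hΩB hPB u vv hun
  have hE'T : E' ∈ torusT' W := torusPtK_mem_torusT' W hΩ hΩB hQB u' vv' hu'n
  -- `γ′ = E γ E′` in `G(𝔸)`
  have hGA : (γ' : GA W) = E * (γ : GA W) * E' := by
    apply Subtype.ext
    apply Units.ext
    change GA.mat W (γ' : GA W) = GA.mat W (E * (γ : GA W) * E')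
    rw [GA.mat_mul, GA.mat_mul, hE, hE', mat_torusPtK, mat_torusPtK, ← hg, ← hg', ← adMat_mul, ← adMat_mul, hconj]
  -- the double cosets coincide
  unfold Setting.orbitOf
  rw [DoubleCoset.eq]
  refine ⟨⟨E, hErat⟩, Subgroup.mem_subgroupOf.2 hET, ⟨E', hE'rat⟩, Subgroup.mem_subgroupOf.2 hE'T, ?_⟩
  apply Subtype.ext
  exact hGA

end Setting


end Summit.Ventures.HodgeRepro.Tier4.Line4

end
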